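import Summits.ResolutionOfSingularities.ResolutionOfSingularities.Theorems.WeightedInvariantIota3FlagTools
import Summits.ResolutionOfSingularities.ResolutionOfSingularities.Theorems.WeightedInvariantP3bDrop
import HarnessLib

/-!
# (iso-succ), PART B: a σ-maximiser flag is EXACT — no re-flagging `g₁ ↦ G₁` makes the weighted initial form a pure `ν`-th power

W4.3 hypersurface-centre programme, crux `HypersurfaceCentreConstruction` (stmt-ResolutionOfSingularities-19897), local engine
(stmt-ResolutionOfSingularities-8899); res-L1-w43-plan-1 DEALS gen 11 #2, ORDER (o42) «tame point-centre drop — proof design + first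
kernel lemma (iso-succ)», res-type-073.  This module is the RING-SIDE half of (iso-succ) in the σ-maximiser language of
`WeightedInvariantIota3Sigma` (p528355) / `WeightedInvariantP3bDrop` (res-D-pv-061, p529577: `IsSigmaMaximiser`), using res-type-070's
membership tools (`WeightedInvariantIota3FlagTools`).

THE STEP.  Let `(g₁, g₂; q, r₁, r₂)` be a σ-MAXIMISER two-flag of `f` at order `ν ≥ 1` (admissible weights `r₁/q ≥ r₂/q ≥ 1`, `f` in level
`r₁ν` of the flag filtration, and no admissible triple reached by ANY two-flag has a larger ratio `r₁'/r₂'`, ties broken by `r₁'/q'`).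
Suppose some two-flag `(G₁, G₂)` and some `c ∈ S` had `f − c·G₁^ν` in level `r₁ν + 1` of the `(q, r₁, r₂)`-filtration of `(G₁, G₂)` — in
words: the weighted initial form of `f` along `(G₁, G₂)` is the pure power `c̄·Ḡ₁^ν` (the case `G₁ = g₁ + φ(x, g₂)` of the (iso-succ)
degree count, and the case `c = 0`: `f` sits strictly above its level).  Then RESCALING the weights to `(νq, νr₁ + 1, νr₂)` — the same flag,
the first member one notch heavier — keeps `f` in level `(νr₁ + 1)·ν` (`flagContactFiltration_le_rescale`: every old piece
`G₁^α G₂^β 𝔪^⌈(N − r₁α − r₂β)/q⌉` lies in the new level `νN`, because the new weight of the monomial is `ν·(old weight) + α`), so `f`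
REACHES the admissible triple `(νq, νr₁ + 1, νr₂)` whose ratio `(νr₁ + 1)/(νr₂)` is STRICTLY LARGER than `r₁/r₂` — contradicting
ratio-maximality (`IsSigmaMaximiser.false_of_sub_mem_succ_level`).  COROLLARIES: a σ-maximiser flag is exact
(`IsSigmaMaximiser.not_mem_succ_level`: `f ∉` level `r₁ν + 1`), and admits no pure-power initial form along any two-flag
(`IsSigmaMaximiser.not_sub_pow_mem_succ_level`).

PART A (the graded degree count in `k[x̄, ḡ₂, ḡ₁]`: `G^ν ∣ in_w f`, `G` weighted-homogeneous of positive degree ⇒ `in_w f = c̄·G^ν` with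
`G = a·ḡ₁ + φ(x̄, ḡ₂)`) and PART C (the position corollary: successors over `𝔪` with `ν' = ν` are isolated in the orbit space) are the
sequel; PART B is what turns PART A's conclusion into a contradiction.

All statements are folklore weighted-filtration bookkeeping about OUR predicates ([OURS] defs of p528355 / p529577); nothing here is a
cited theorem.  Programme reference: [cite: AbramovichTemkinWlodarczyk2024, §5 (maximal contact and the invariant)].
-/

open IsLocalRing
open Summit.ResolutionOfSingularities.ResolutionOfSingularities.Theorems

set_option linter.dupNamespace false -- mandated namespace of this single-conjunct summit

namespace Summit.ResolutionOfSingularities.ResolutionOfSingularities.Cruxes.HypersurfaceCentreConstruction.LocalEngine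

namespace Iota3

variable {S : Type} [CommRing S] [IsLocalRing S]

/-! ## Arithmetic of the ceiling exponent -/

/-- The ceiling property of the exponent `⌈(N − A)/q⌉ = (N − A + q − 1)/q` (`q > 0`): `N ≤ A + q·⌈(N − A)/q⌉`. [folklore] -/
theorem le_add_mul_cdiv {q : ℕ} (hq : 0 < q) (N A : ℕ) : N ≤ A + q * ((N - A + q - 1) / q) := by
  have h1 : N - A + q - 1 < (N - A + q - 1) / q * q + q := Nat.lt_div_mul_add hq
  generalize (N - A + q - 1) / q = e at h1 ⊢
  obtain ⟨P, hP1, hP2⟩ : ∃ P, e * q = P ∧ q * e = P := ⟨e * q, rfl, mul_comm _ _⟩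
  rw [hP1] at h1
  rw [hP2]
  omega

/-- **The rescaled weight dominates**: with `e = ⌈(N − r₁α − r₂β)/q⌉` the old exponent of the piece `(α, β)` at level `N`,
the monomial `G₁^α G₂^β · 𝔪ᵉ` has NEW weight `(νr₁ + 1)α + νr₂β + νq·e ≥ νN`. [folklore] -/
theorem rescale_weight_le {q : ℕ} (hq : 0 < q) (ν N r₁ r₂ α β : ℕ) :
    ν * N ≤ (ν * r₁ + 1) * α + ν * r₂ * β + ν * q * ((N - r₁ * α - r₂ * β + q - 1) / q) := by
  have h0 : N ≤ r₁ * α + r₂ * β + q * ((N - (r₁ * α + r₂ * β) + q - 1) / q) := le_add_mul_cdiv hq N _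
  rw [← Nat.sub_sub] at h0
  generalize (N - r₁ * α - r₂ * β + q - 1) / q = e at h0 ⊢
  calc ν * N ≤ ν * (r₁ * α + r₂ * β + q * e) := Nat.mul_le_mul_left ν h0
    _ ≤ ν * (r₁ * α + r₂ * β + q * e) + α := Nat.le_add_right _ _
    _ = (ν * r₁ + 1) * α + ν * r₂ * β + ν * q * e := by ring

/-! ## Rescaling the weights of a flag -/

/-- **Rescaling**: level `N` of the `(q, r₁, r₂)`-filtration of a flag lies in level `νN` of its `(νq, νr₁ + 1, νr₂)`-filtration
(`q, ν > 0`): the first member made one notch heavier after scaling all weights by `ν`. [folklore] -/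
theorem flagContactFiltration_le_rescale {q ν : ℕ} (hq : 0 < q) (hν : 0 < ν) (G₁ G₂ : S) (r₁ r₂ N : ℕ) :
    flagContactFiltration G₁ G₂ q r₁ r₂ N ≤ flagContactFiltration G₁ G₂ (ν * q) (ν * r₁ + 1) (ν * r₂) (ν * N) := by
  have hq' : 0 < ν * q := Nat.mul_pos hν hq
  rw [flagContactFiltration_def G₁ G₂ q r₁ r₂ N]
  refine iSup_le fun α => iSup_le fun β => ?_
  rw [Ideal.mul_le]
  intro s hs c hc
  obtain ⟨t, rfl⟩ := Ideal.mem_span_singleton'.mp hs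
  have hmem : G₁ ^ α * G₂ ^ β * c * t ∈ flagContactFiltration G₁ G₂ (ν * q) (ν * r₁ + 1) (ν * r₂) (ν * N) :=
    mul_unit_mem_flagContactFiltration t
      (mul_mem_flagContactFiltration_of_weight hq' hc (rescale_weight_le hq ν N r₁ r₂ α β))
  have e : t * (G₁ ^ α * G₂ ^ β) * c = G₁ ^ α * G₂ ^ β * c * t := by ring
  rw [e]
  exact hmem

/-- **A pure-power initial form lifts the flag one notch**: if `f − c·G₁^ν` lies in level `r₁ν + 1` of the `(q, r₁, r₂)`-filtration of
`(G₁, G₂)` then `f` lies in level `(νr₁ + 1)·ν` of its `(νq, νr₁ + 1, νr₂)`-filtration (`q, ν > 0`). [folklore] -/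
theorem mem_rescale_of_sub_pow_mem_succ_level {q ν : ℕ} (hq : 0 < q) (hν : 0 < ν) {f c G₁ G₂ : S} {r₁ r₂ : ℕ}
    (h : f - c * G₁ ^ ν ∈ flagContactFiltration G₁ G₂ q r₁ r₂ (r₁ * ν + 1)) :
    f ∈ flagContactFiltration G₁ G₂ (ν * q) (ν * r₁ + 1) (ν * r₂) ((ν * r₁ + 1) * ν) := by
  have h1 : f - c * G₁ ^ ν ∈ flagContactFiltration G₁ G₂ (ν * q) (ν * r₁ + 1) (ν * r₂) ((ν * r₁ + 1) * ν) := by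
    have h' := flagContactFiltration_le_rescale hq hν G₁ G₂ r₁ r₂ (r₁ * ν + 1) h
    have e : ν * (r₁ * ν + 1) = (ν * r₁ + 1) * ν := by ring
    rw [e] at h'
    exact h'
  have h2 : c * G₁ ^ ν ∈ flagContactFiltration G₁ G₂ (ν * q) (ν * r₁ + 1) (ν * r₂) ((ν * r₁ + 1) * ν) := by
    rw [mul_comm c]
    exact mul_unit_mem_flagContactFiltration c
      (pow_left_mem_flagContactFiltration (g₂ := G₂) (q := ν * q) (r₁ := ν * r₁ + 1) (r₂ := ν * r₂) (n := (ν * r₁ + 1) * ν)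
        (α := ν) (Nat.mul_pos hν hq) le_rfl)
  have e : f = (f - c * G₁ ^ ν) + c * G₁ ^ ν := by ring
  rw [e]
  exact add_mem h1 h2

/-- … hence `f` REACHES the admissible triple `(νq, νr₁ + 1, νr₂)` as soon as `(G₁, G₂)` is a two-flag. [folklore] -/
theorem flagReaches_rescale_of_sub_pow_mem_succ_level {q ν : ℕ} (hq : 0 < q) (hν : 0 < ν) {f c G₁ G₂ : S} {r₁ r₂ : ℕ}
    (hG : IsTwoFlag G₁ G₂) (h : f - c * G₁ ^ ν ∈ flagContactFiltration G₁ G₂ q r₁ r₂ (r₁ * ν + 1)) :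
    FlagReaches f ν (ν * q) (ν * r₁ + 1) (ν * r₂) :=
  ⟨G₁, G₂, hG, mem_rescale_of_sub_pow_mem_succ_level hq hν h⟩

/-- The rescaled triple is admissible when the old one is and `ν ≥ 1`. [folklore] -/
theorem admissibleTriple_rescale {q r₁ r₂ ν : ℕ} (h : AdmissibleTriple q r₁ r₂) (hν : 0 < ν) :
    AdmissibleTriple (ν * q) (ν * r₁ + 1) (ν * r₂) := by
  obtain ⟨hq, hqr, hrr⟩ := h
  exact ⟨Nat.mul_pos hν hq, Nat.mul_le_mul_left ν hqr, (Nat.mul_le_mul_left ν hrr).trans (Nat.le_succ _)⟩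

/-! ## A σ-maximiser flag is exact -/

/-- **(iso-succ), ring side.**  A σ-maximiser two-flag `(g₁, g₂; q, r₁, r₂)` of `f` at order `ν ≥ 1` admits NO two-flag `(G₁, G₂)` and
NO `c ∈ S` with `f − c·G₁^ν` in level `r₁ν + 1` of the `(q, r₁, r₂)`-filtration of `(G₁, G₂)`: otherwise `f` reaches
`(νq, νr₁ + 1, νr₂)`, of ratio `(νr₁ + 1)/(νr₂) > r₁/r₂`, against ratio-maximality. [folklore] -/
theorem IsSigmaMaximiser.false_of_sub_pow_mem_succ_level {f : S} {ν : ℕ} {g₁ g₂ : S} {q r₁ r₂ : ℕ}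
    (hmax : IsSigmaMaximiser f ν g₁ g₂ q r₁ r₂) (hν : 0 < ν) {G₁ G₂ c : S} (hG : IsTwoFlag G₁ G₂)
    (h : f - c * G₁ ^ ν ∈ flagContactFiltration G₁ G₂ q r₁ r₂ (r₁ * ν + 1)) : False := by
  obtain ⟨hadm, -, -, hmaxi⟩ := hmax
  have hq : 0 < q := hadm.1
  have hr₂ : 0 < r₂ := lt_of_lt_of_le hq hadm.2.1
  have hreach := flagReaches_rescale_of_sub_pow_mem_succ_level hq hν hG h
  have key := hmaxi (ν * q) (ν * r₁ + 1) (ν * r₂) (admissibleTriple_rescale hadm hν) hreach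
  have e1 : (ν * r₁ + 1) * r₂ = ν * r₁ * r₂ + r₂ := by ring
  have e2 : r₁ * (ν * r₂) = ν * r₁ * r₂ := by ring
  rw [e1, e2] at key
  omega

/-- **A σ-maximiser flag is EXACT**: `f` is not in level `r₁ν + 1` of its own filtration (`ν ≥ 1`). [folklore] -/
theorem IsSigmaMaximiser.not_mem_succ_level {f : S} {ν : ℕ} {g₁ g₂ : S} {q r₁ r₂ : ℕ}
    (hmax : IsSigmaMaximiser f ν g₁ g₂ q r₁ r₂) (hν : 0 < ν) :
    f ∉ flagContactFiltration g₁ g₂ q r₁ r₂ (r₁ * ν + 1) := by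
  intro h
  refine hmax.false_of_sub_pow_mem_succ_level hν hmax.2.1 (c := 0) ?_
  simpa using h

/-- **No pure-power initial form along any two-flag**: for a σ-maximiser `(g₁, g₂; q, r₁, r₂)` of `f` at order `ν ≥ 1`, every
two-flag `(G₁, G₂)` and every `c` have `f − c·G₁^ν ∉` level `r₁ν + 1` of the `(q, r₁, r₂)`-filtration of `(G₁, G₂)` — the form in
which PART A's degree count (`in_w f = c̄·(ḡ₁ + φ̄)^ν`) is contradicted. [folklore] -/
theorem IsSigmaMaximiser.not_sub_pow_mem_succ_level {f : S} {ν : ℕ} {g₁ g₂ : S} {q r₁ r₂ : ℕ}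
    (hmax : IsSigmaMaximiser f ν g₁ g₂ q r₁ r₂) (hν : 0 < ν) {G₁ G₂ : S} (hG : IsTwoFlag G₁ G₂) (c : S) :
    f - c * G₁ ^ ν ∉ flagContactFiltration G₁ G₂ q r₁ r₂ (r₁ * ν + 1) :=
  fun h => hmax.false_of_sub_pow_mem_succ_level hν hG h

end Iota3

end Summit.ResolutionOfSingularities.ResolutionOfSingularities.Cruxes.HypersurfaceCentreConstruction.LocalEngine
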